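import Summits.QuantumFields.YangMills.Theorems.PoincareLipschitzConeLinkChartIntegral
import Summits.QuantumFields.YangMills.Theorems.PoincareLipschitzConeLinkDilation
import Summits.QuantumFields.YangMills.Theorems.PoincareLipschitzConeLinkSlice
import Mathlib.Analysis.Normed.Operator.BoundedLinearMaps
import HarnessLib

/-!
# Crux `BlockLipschitzL` (stmt-QuantumFields-23533) ∕ `HistoryTailL` (stmt-QuantumFields-19936), LINE 25 «CompactnessTransfer»,
# stub S1″ — ROAD (H) «SU(2) currents ⇒ H-system ⇒ 8π quantum», brick (T) «CONE → PLANE TRANSPORT», FILE D3 «THE LINK ON A GOOD SLICE»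

Cell `ym3-torus` (YM ladder rung R3 = continuum SU(2) Yang–Mills on T³ — a RUNG, NOT Clay: not d = 4, not infinite volume,
not a mass gap); WIDTH helper seat `ym3-torus-px14` g7 (brick (T) of px19 g8's ROAD (H), architecture v1).  Helper
`--supports stmt-QuantumFields-23533`; THEOREMS ONLY (0 `def`, 0 `sorry`, default heartbeats); imports px16 g10's
✓`PoincareLipschitzConeLinkChartIntegral` (chart, null-set pull-back), FILE B ✓`PoincareLipschitzConeLinkDilation` (dilation
invariance), FILE C ✓`PoincareLipschitzConeLinkSlice` (good slices), Mathlib.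

WHAT THIS FILE PROVES — THE DISCHARGE OF THE D-ROW LETTERS (`LETTERS-D-rows.px14g7.txt`).  For `U` with weak gradient `G` on the
ball `B = B_{1∕4}(0) ⊂ E³` and VANISHING RADIAL DERIVATIVE `G x (x) = 0` a.e. on `B`, there is a GOOD HEIGHT `t₀ ∈ (0, 1∕4)` such that
the link `w := U ∘ (t₀•σ)` and `Gw := (G ∘ (t₀•σ)) ∘L (t₀ • Dσ)` satisfy, for a.e. `q = (t,y)` in the slab `S = (0,1∕4) × E²`:
`U (t•σ y) = w y` (★★★ `hVw`), `(G (t•σ y)) ∘L (t • Dσ_y) = Gw y` (★★★ `hHw`), `G (t•σ y) (σ y) = 0` (★ `hradS`); and `w`, `Gw` are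
a.e.-strongly measurable (★★★ `exists_goodSlice_link`).  Proof: FILE B makes `U`, `G` invariant ∕ degree `−1` under every dilation,
a.e. on `B` (one null set per `s`); strongly measurable representatives and the null-set pull-back of the chart turn this into
the dilation invariance of `q ↦ (Ũ(t•σy), (G̃(t•σy)) ∘L (t•Dσ_y))` on `S`; FILE C gives a.e. height good; intersecting with the
heights where the representatives agree with `U`, `G` along the slice picks `t₀`.

HONEST SCOPE.  Measure theory; nothing of (GAP)∕(TM), (C), S1″, K1, `MeanDeviationL`, `BlockLipschitzL`, `HistoryTailL` is proved
here.  YM₃ on T³ is rung R3, not Clay; YM gap NOT proved; no summit statement is proved here.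

References: L. Simon, Theorems on Regularity and Singularity of Energy Minimizing Maps (1996) [Simon1996] (§3.1, homogeneous
degree-zero minimizers and their links); L. C. Evans, R. F. Gariepy, Measure Theory and Fine Properties of Functions (1992)
[EvansGariepy1992] (§3.3.3).
-/

set_option autoImplicit false

noncomputable section

open MeasureTheory Set Function Filter Topology Metric TopologicalSpace
open scoped RealInnerProductSpace BigOperators ContDiff

namespace Summit.QuantumFields.YangMills.Theorems.PoincareLipschitzConeLinkGoodSlice

open Literature.Analysis.FunctionSpaces (HasWeakFDerivOn)
open Summit.QuantumFields.YangMills.Theorems.PoincareLipschitzConeLinkChart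
open Summit.QuantumFields.YangMills.Theorems.PoincareLipschitzConeLinkDilation
open Summit.QuantumFields.YangMills.Theorems.PoincareLipschitzConeLinkSlice

variable {c : EuclideanSpace ℝ (Fin 2) → ℝ} {σ : EuclideanSpace ℝ (Fin 2) → EuclideanSpace ℝ (Fin 3)}

/-! ## §1 The slab and the ball -/

/-- Balls centred at the origin are star-shaped towards the origin. [folklore] -/
theorem inv_smul_mem_ball {r : ℝ} {x : EuclideanSpace ℝ (Fin 3)} (hx : x ∈ ball (0 : EuclideanSpace ℝ (Fin 3)) r)
    {s : ℝ} (hs : 1 ≤ s) : s⁻¹ • x ∈ ball (0 : EuclideanSpace ℝ (Fin 3)) r := by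
  rw [mem_ball_zero_iff] at hx ⊢
  rw [norm_smul, Real.norm_eq_abs, abs_of_pos (inv_pos.2 (lt_of_lt_of_le one_pos hs))]
  calc s⁻¹ * ‖x‖ ≤ 1 * ‖x‖ := by gcongr; exact inv_le_one_of_one_le₀ hs
    _ < r := by rw [one_mul]; exact hx

/-- The chart maps the slab `(0,R) × E²` into the ball `B_R(0)`. [folklore] -/
theorem smul_sigma_mem_ball (hc : ∀ y, c y = 2 / (1 + ‖y‖ ^ 2))
    (hσ : ∀ y, σ y = !₂[c y * y 0, c y * y 1, c y - 1]) {R : ℝ} {q : ℝ × EuclideanSpace ℝ (Fin 2)}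
    (hq : q ∈ Ioo (0:ℝ) R ×ˢ (univ : Set (EuclideanSpace ℝ (Fin 2)))) :
    q.1 • σ q.2 ∈ ball (0 : EuclideanSpace ℝ (Fin 3)) R := by
  rw [mem_ball_zero_iff, norm_smul_sigma hc hσ, abs_of_pos (mem_prod.1 hq).1.1]
  exact (mem_prod.1 hq).1.2

/-- **Null sets of the ball pull back to null sets of the slab** (a.e. form): an a.e. property on `B_R(0)` holds at `t•σ y` for
a.e. `(t,y)` in the slab. [cite: EvansGariepy1992, §3.3.3] -/
theorem ae_slab_of_ae_ball (hc : ∀ y, c y = 2 / (1 + ‖y‖ ^ 2))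
    (hσ : ∀ y, σ y = !₂[c y * y 0, c y * y 1, c y - 1]) {R : ℝ} {p : EuclideanSpace ℝ (Fin 3) → Prop}
    (h : ∀ᵐ x ∂(volume.restrict (ball (0 : EuclideanSpace ℝ (Fin 3)) R)), p x) :
    ∀ᵐ q ∂(volume.restrict (Ioo (0:ℝ) R ×ˢ (univ : Set (EuclideanSpace ℝ (Fin 2))))), p (q.1 • σ q.2) := by
  rw [ae_restrict_iff' measurableSet_ball, ae_iff] at h
  have h0 := volume_chart_preimage_null hc hσ h
  rw [ae_restrict_iff' (measurableSet_Ioo.prod MeasurableSet.univ), ae_iff]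
  refine measure_mono_null (fun q hq => ?_) h0
  obtain ⟨hqS, hnp⟩ := Classical.not_imp.1 hq
  exact ⟨(mem_prod.1 hqS).1.1, fun himp => hnp (himp (smul_sigma_mem_ball hc hσ hqS))⟩

/-- An a.e. property on the ball, precomposed with the dilation `x ↦ s⁻¹ • x` (`s ≥ 1`), still holds a.e. on the ball.
[folklore] -/
theorem ae_ball_comp_inv_smul {R : ℝ} {p : EuclideanSpace ℝ (Fin 3) → Prop}
    (h : ∀ᵐ x ∂(volume.restrict (ball (0 : EuclideanSpace ℝ (Fin 3)) R)), p x) {s : ℝ} (hs : 1 ≤ s) :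
    ∀ᵐ x ∂(volume.restrict (ball (0 : EuclideanSpace ℝ (Fin 3)) R)), p (s⁻¹ • x) := by
  have hs0 : s⁻¹ ≠ 0 := inv_ne_zero (lt_of_lt_of_le one_pos hs).ne'
  rw [ae_restrict_iff' measurableSet_ball, ae_iff] at h ⊢
  have h1 : volume ((fun x : EuclideanSpace ℝ (Fin 3) => s⁻¹ • x) ⁻¹' {x | ¬(x ∈ ball (0 : EuclideanSpace ℝ (Fin 3)) R → p x)}) = 0 := by
    rw [Measure.addHaar_preimage_smul volume hs0, h, mul_zero]
  refine measure_mono_null (fun x hx => ?_) h1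
  obtain ⟨hxB, hnp⟩ := Classical.not_imp.1 hx
  exact fun himp => hnp (himp (inv_smul_mem_ball hxB hs))

/-- The slab measure is the product of Lebesgue measure on `(0,R)` with Lebesgue measure on `E²`. [folklore] -/
theorem volume_restrict_slab (R : ℝ) :
    (volume.restrict (Ioo (0:ℝ) R ×ˢ (univ : Set (EuclideanSpace ℝ (Fin 2)))) : Measure (ℝ × EuclideanSpace ℝ (Fin 2))) =
      (volume.restrict (Ioo (0:ℝ) R)).prod (volume : Measure (EuclideanSpace ℝ (Fin 2))) := by
  rw [show (volume : Measure (ℝ × EuclideanSpace ℝ (Fin 2))) = (volume : Measure ℝ).prod volume from rfl,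
    ← Measure.prod_restrict, Measure.restrict_univ]

/-- An a.e. property of `y ∈ E²` holds for a.e. `q` in the slab at `q.2`. [folklore] -/
theorem ae_slab_of_ae_snd {R : ℝ} {p : EuclideanSpace ℝ (Fin 2) → Prop} (h : ∀ᵐ y ∂(volume : Measure (EuclideanSpace ℝ (Fin 2))), p y) :
    ∀ᵐ q ∂(volume.restrict (Ioo (0:ℝ) R ×ˢ (univ : Set (EuclideanSpace ℝ (Fin 2))))), p q.2 := by
  rw [volume_restrict_slab]
  exact (Measure.quasiMeasurePreserving_snd (μ := volume.restrict (Ioo (0:ℝ) R))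
    (ν := (volume : Measure (EuclideanSpace ℝ (Fin 2))))).ae h

/-! ## §2 The link on a good slice -/

/-- ★★★ **THE LINK ON A GOOD SLICE.**  Let `U : E³ → E⁴` have the weak gradient `G` on the ball `B_{1∕4}(0)` with
`G x (x) = 0` for a.e. `x` (radial constancy).  Then for some height `t₀ ∈ (0, 1∕4)` the link `w := U ∘ (t₀•σ)` and
`Gw := (G ∘ (t₀•σ)) ∘L (t₀ • Dσ)` are a.e.-strongly measurable and, for a.e. `(t,y)` in the slab `(0,1∕4) × E²`,
`U (t•σ y) = w y` and `(G (t•σ y)) ∘L (t • Dσ_y) = Gw y`. [cite: Simon1996, §3.1 (tangent maps are homogeneous of degree zero; their links)] -/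
theorem exists_goodSlice_link (hc : ∀ y, c y = 2 / (1 + ‖y‖ ^ 2))
    (hσ : ∀ y, σ y = !₂[c y * y 0, c y * y 1, c y - 1])
    {U : EuclideanSpace ℝ (Fin 3) → EuclideanSpace ℝ (Fin 4)}
    {G : EuclideanSpace ℝ (Fin 3) → (EuclideanSpace ℝ (Fin 3) →L[ℝ] EuclideanSpace ℝ (Fin 4))}
    (hU : HasWeakFDerivOn ⟨ball (0 : EuclideanSpace ℝ (Fin 3)) (1/4), isOpen_ball⟩ volume U G)
    (hrad : ∀ᵐ x ∂(volume.restrict (ball (0 : EuclideanSpace ℝ (Fin 3)) (1/4))), G x x = 0) :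
    ∃ t₀ ∈ Ioo (0:ℝ) (1/4),
      AEStronglyMeasurable (fun y => U (t₀ • σ y)) volume ∧
      AEStronglyMeasurable (fun y => (G (t₀ • σ y)).comp (t₀ • fderiv ℝ σ y)) volume ∧
      (∀ᵐ q ∂(volume.restrict (Ioo (0:ℝ) (1/4) ×ˢ (univ : Set (EuclideanSpace ℝ (Fin 2))))),
        U (q.1 • σ q.2) = U (t₀ • σ q.2)) ∧
      (∀ᵐ q ∂(volume.restrict (Ioo (0:ℝ) (1/4) ×ˢ (univ : Set (EuclideanSpace ℝ (Fin 2))))),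
        (G (q.1 • σ q.2)).comp (q.1 • fderiv ℝ σ q.2) = (G (t₀ • σ q.2)).comp (t₀ • fderiv ℝ σ q.2)) := by
  have hσs := contDiff_sigma hc hσ
  have hstar : ∀ x ∈ ((⟨ball (0 : EuclideanSpace ℝ (Fin 3)) (1/4), isOpen_ball⟩ : Opens (EuclideanSpace ℝ (Fin 3))) : Set _),
      ∀ s : ℝ, 1 ≤ s → s⁻¹ • x ∈ ((⟨ball (0 : EuclideanSpace ℝ (Fin 3)) (1/4), isOpen_ball⟩ : Opens (EuclideanSpace ℝ (Fin 3))) : Set _) :=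
    fun x (hx : x ∈ ball (0 : EuclideanSpace ℝ (Fin 3)) (1/4)) s hs =>
      (inv_smul_mem_ball hx hs : s⁻¹ • x ∈ ball (0 : EuclideanSpace ℝ (Fin 3)) (1/4))
  -- strongly measurable representatives
  set Ut := (hU.locallyIntegrableOn.aestronglyMeasurable).mk U with hUt
  set Gt := (hU.locallyIntegrableOn_deriv.aestronglyMeasurable).mk G with hGt
  have hUtm : StronglyMeasurable Ut := hU.locallyIntegrableOn.aestronglyMeasurable.stronglyMeasurable_mk
  have hGtm : StronglyMeasurable Gt := hU.locallyIntegrableOn_deriv.aestronglyMeasurable.stronglyMeasurable_mk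
  have hUU : ∀ᵐ x ∂(volume.restrict (ball (0 : EuclideanSpace ℝ (Fin 3)) (1/4))), U x = Ut x :=
    hU.locallyIntegrableOn.aestronglyMeasurable.ae_eq_mk
  have hGG : ∀ᵐ x ∂(volume.restrict (ball (0 : EuclideanSpace ℝ (Fin 3)) (1/4))), G x = Gt x :=
    hU.locallyIntegrableOn_deriv.aestronglyMeasurable.ae_eq_mk
  -- the dilation-invariant function on the slab
  set f : ℝ × EuclideanSpace ℝ (Fin 2) → EuclideanSpace ℝ (Fin 4) × (EuclideanSpace ℝ (Fin 2) →L[ℝ] EuclideanSpace ℝ (Fin 4)) :=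
    fun q => (Ut (q.1 • σ q.2), (Gt (q.1 • σ q.2)).comp (q.1 • fderiv ℝ σ q.2)) with hf
  have hΦc : Continuous fun q : ℝ × EuclideanSpace ℝ (Fin 2) => q.1 • σ q.2 :=
    continuous_fst.smul (hσs.continuous.comp continuous_snd)
  have hLc : Continuous fun q : ℝ × EuclideanSpace ℝ (Fin 2) => q.1 • fderiv ℝ σ q.2 :=
    continuous_fst.smul ((hσs.continuous_fderiv (by simp)).comp continuous_snd)
  have hfm : StronglyMeasurable f := by
    refine StronglyMeasurable.prodMk (hUtm.comp_measurable hΦc.measurable) ?_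
    have h1 : StronglyMeasurable fun q : ℝ × EuclideanSpace ℝ (Fin 2) => (Gt (q.1 • σ q.2), q.1 • fderiv ℝ σ q.2) :=
      (hGtm.comp_measurable hΦc.measurable).prodMk hLc.stronglyMeasurable
    exact (isBoundedBilinearMap_comp (𝕜 := ℝ) (E := EuclideanSpace ℝ (Fin 2)) (F := EuclideanSpace ℝ (Fin 3))
      (G := EuclideanSpace ℝ (Fin 4))).continuous.comp_stronglyMeasurable h1
  -- dilation invariance of `f` on the slab
  have hinv : ∀ s : ℝ, 1 ≤ s → ∀ᵐ q ∂(volume.restrict (Ioo (0:ℝ) (1/4) ×ˢ (univ : Set (EuclideanSpace ℝ (Fin 2))))),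
      f (q.1 / s, q.2) = f q := by
    intro s hs
    have hs0 : 0 < s := lt_of_lt_of_le one_pos hs
    have h1 := ae_eq_comp_inv_smul hstar hU hrad hs
    have h2 := ae_eq_smul_weakGrad_comp_inv_smul hstar hU hrad hs
    have h3 := ae_ball_comp_inv_smul hUU hs
    have h4 := ae_ball_comp_inv_smul hGG hs
    have h := ae_slab_of_ae_ball hc hσ (R := 1/4) (((h1.and h2).and (h3.and h4)).and (hUU.and hGG))
    filter_upwards [h, ae_restrict_mem (measurableSet_Ioo.prod MeasurableSet.univ)] with q hq hqS
    obtain ⟨⟨⟨e1, e2⟩, ⟨e3, e4⟩⟩, ⟨e5, e6⟩⟩ := hq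
    have ht : 0 < q.1 := (mem_prod.1 hqS).1.1
    have hsm : (q.1 / s) • σ q.2 = s⁻¹ • (q.1 • σ q.2) := by rw [smul_smul, div_eq_inv_mul]
    simp only [hf, Prod.mk.injEq]
    refine ⟨?_, ?_⟩
    · rw [hsm, ← e3, e1, e5]
    · rw [hsm, ← e4, e2, e6, ContinuousLinearMap.smul_comp, ContinuousLinearMap.comp_smul,
        ContinuousLinearMap.comp_smul, smul_smul, mul_div_cancel₀ _ hs0.ne']
  -- good heights: slices of `f`, and agreement of the representatives along the slice
  have hgood := ae_good_slice hfm (by norm_num : (0:ℝ) < 1/4) hinv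
  have hagree : ∀ᵐ t₀ ∂(volume.restrict (Ioo (0:ℝ) (1/4))), ∀ᵐ y ∂(volume : Measure (EuclideanSpace ℝ (Fin 2))),
      U (t₀ • σ y) = Ut (t₀ • σ y) ∧ G (t₀ • σ y) = Gt (t₀ • σ y) := by
    have h := ae_slab_of_ae_ball hc hσ (R := 1/4) (hUU.and hGG)
    rw [volume_restrict_slab] at h
    exact Measure.ae_ae_of_ae_prod h
  obtain ⟨t₀, ht₀, hslice, hag⟩ :=
    exists_mem_Ioo_of_ae (by norm_num : (0:ℝ) < 1/4) Subset.rfl (hgood.and hagree)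
  refine ⟨t₀, ht₀, ?_, ?_, ?_, ?_⟩
  · -- measurability of `w`
    refine ⟨fun y => Ut (t₀ • σ y), hUtm.comp_measurable (hΦc.comp (Continuous.prodMk_right t₀)).measurable, ?_⟩
    filter_upwards [hag] with y hy
    exact hy.1
  · -- measurability of `Gw`
    refine ⟨fun y => (Gt (t₀ • σ y)).comp (t₀ • fderiv ℝ σ y), ?_, ?_⟩
    · have h1 : StronglyMeasurable fun y : EuclideanSpace ℝ (Fin 2) => (Gt (t₀ • σ y), t₀ • fderiv ℝ σ y) :=
        (hGtm.comp_measurable (hΦc.comp (Continuous.prodMk_right t₀)).measurable).prodMk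
          (hLc.comp (Continuous.prodMk_right t₀)).stronglyMeasurable
      exact (isBoundedBilinearMap_comp (𝕜 := ℝ) (E := EuclideanSpace ℝ (Fin 2)) (F := EuclideanSpace ℝ (Fin 3))
        (G := EuclideanSpace ℝ (Fin 4))).continuous.comp_stronglyMeasurable h1
    · filter_upwards [hag] with y hy
      simp only [hy.2]
  · -- `U (t•σ y) = w y` a.e. on the slab
    have h := ae_slab_of_ae_ball hc hσ (R := 1/4) hUU
    filter_upwards [h, hslice, ae_slab_of_ae_snd (R := 1/4) hag] with q h1 h2 h3
    have h2' := congrArg Prod.fst h2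
    simp only [hf] at h2'
    rw [h1, h2', ← h3.1]
  · -- `(G (t•σ y)) ∘L (t • Dσ_y) = Gw y` a.e. on the slab
    have h := ae_slab_of_ae_ball hc hσ (R := 1/4) hGG
    filter_upwards [h, hslice, ae_slab_of_ae_snd (R := 1/4) hag] with q h1 h2 h3
    have h2' := congrArg Prod.snd h2
    simp only [hf] at h2'
    rw [h1, h2', ← h3.2]

/-- ★ **RADIAL CONSTANCY ON THE SLAB**: `G (t•σ y) (σ y) = 0` for a.e. `(t,y)` in the slab. [cite: Simon1996, §3.1] -/
theorem ae_slab_weakGrad_sigma_eq_zero (hc : ∀ y, c y = 2 / (1 + ‖y‖ ^ 2))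
    (hσ : ∀ y, σ y = !₂[c y * y 0, c y * y 1, c y - 1]) {F : Type*} [NormedAddCommGroup F] [NormedSpace ℝ F]
    {G : EuclideanSpace ℝ (Fin 3) → (EuclideanSpace ℝ (Fin 3) →L[ℝ] F)} {R : ℝ}
    (hrad : ∀ᵐ x ∂(volume.restrict (ball (0 : EuclideanSpace ℝ (Fin 3)) R)), G x x = 0) :
    ∀ᵐ q ∂(volume.restrict (Ioo (0:ℝ) R ×ˢ (univ : Set (EuclideanSpace ℝ (Fin 2))))), G (q.1 • σ q.2) (σ q.2) = 0 := by
  filter_upwards [ae_slab_of_ae_ball hc hσ hrad, ae_restrict_mem (measurableSet_Ioo.prod MeasurableSet.univ)] with q hq hqS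
  have ht : 0 < q.1 := (mem_prod.1 hqS).1.1
  rw [map_smul] at hq
  exact (smul_eq_zero.1 hq).resolve_left ht.ne'

end Summit.QuantumFields.YangMills.Theorems.PoincareLipschitzConeLinkGoodSlice

end
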